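import Literature.Analysis.Matrix.SignatureTwoOneEigenvector
import Mathlib.Analysis.Calculus.ImplicitContDiff
import Mathlib.Analysis.Calculus.ContDiff.Operations
import Mathlib.Analysis.Calculus.Deriv.Pow
import Mathlib.Analysis.Calculus.Deriv.Prod
import Mathlib.LinearAlgebra.Matrix.ToLin
import Mathlib.LinearAlgebra.FiniteDimensional.Lemmas
import Mathlib.Topology.Instances.Matrix
import HarnessLib

/-!
# Smooth dependence of the negative eigenvector of a signature-`(2,1)` family on parameters

Topic `Analysis/Matrix`; namespace `Literature.Analysis.Matrix`.  Theorems only; no named fact,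
no `sorry`.  Let `T : ℝ → Mat₃(ℝ)` be a `C^∞` family of real symmetric matrices each of which
has a unit eigenvector of negative eigenvalue with positive-definite orthogonal complement
(signature `(2, 1)`), and let `w : ℝ → ℝ³` be a CONTINUOUS family of negative vectors
(`⟨w θ, T θ w θ⟩ < 0`).  Then the unit negative eigenvector signed by `w`
(`SignatureTwoOneEigenvector.lean`) is a `C^∞` function of `θ`, its eigenvalue is `C^∞`, and both
are `P`-periodic whenever `T` and `w` are (`exists_contDiff_signed_negative_eigenvector`).

Proof: the eigenpair `(n, λ)` at `θ₀` is a zero of `f(θ; v, μ) = (T(θ) v - μ v, ⟨v, v⟩) - (0, 1)`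
whose partial derivative in `(v, μ)`, `(h, η) ↦ ((T - λ) h - η n, 2⟨n, h⟩)`
(`fderiv_inr_apply`, computed through directional derivatives), is injective by simplicity of
`λ` (`linearization_injective`), hence invertible; Mathlib's `C^n` implicit function theorem
(`ContDiffAt.implicitFunction`) continues the eigenpair smoothly, and by continuity the continued
pair keeps a negative eigenvalue and a positive pairing with `w`, so it IS the signed eigenvector
(`signed_negative_eigenvector_unique`), which is therefore smooth at `θ₀`.  This is the smoothness
of the eigenline `L⁻` along a zero circle of a near-symplectic form (Perutz 2006, §2.3 (d),
Prop. 2.2), in the generality needed for Honda's normal form (Honda 2004, Thm. 5).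

## References

* T. Perutz, *Zero-sets of near-symplectic forms*, J. Symplectic Geom. 4 (2006), §2.3, Prop. 2.2. [Perutz2006]
* T. Kato, *Perturbation Theory for Linear Operators* (1966), Ch. II §5, Thm. 5.16 (smooth simple
  eigenvalues and eigenprojections). [folklore]
-/

noncomputable section

namespace Literature.Analysis.Matrix

open _root_.Matrix Filter Topology Set Function
open scoped ContDiff

/-! ### The eigenpair equation and its smoothness -/

/-- The eigenpair map `f(θ; v, μ) = (T(θ) v - μ v, ⟨v, v⟩)`; its zeros over `(0, 1)` are the unit
eigenpairs of `T(θ)`. [folklore] -/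
theorem eigenpairMap_apply (T : ℝ → Matrix (Fin 3) (Fin 3) ℝ) (p : ℝ × ((Fin 3 → ℝ) × ℝ)) :
    (fun p : ℝ × ((Fin 3 → ℝ) × ℝ) ↦ (T p.1 *ᵥ p.2.1 - p.2.2 • p.2.1, p.2.1 ⬝ᵥ p.2.1)) p =
      (T p.1 *ᵥ p.2.1 - p.2.2 • p.2.1, p.2.1 ⬝ᵥ p.2.1) := rfl

/-- `(θ, v) ↦ T(θ) v` is `C^∞` for a `C^∞` family of matrices. [folklore] -/
theorem contDiff_mulVec_family {T : ℝ → Matrix (Fin 3) (Fin 3) ℝ}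
    (hT : ∀ i j, ContDiff ℝ ∞ fun θ ↦ T θ i j) :
    ContDiff ℝ ∞ fun p : ℝ × ((Fin 3 → ℝ) × ℝ) ↦ T p.1 *ᵥ p.2.1 := by
  refine contDiff_pi.2 fun i ↦ ?_
  have h : (fun p : ℝ × ((Fin 3 → ℝ) × ℝ) ↦ (T p.1 *ᵥ p.2.1) i) =
      fun p ↦ ∑ j, T p.1 i j * p.2.1 j := by
    funext p; simp [Matrix.mulVec, dotProduct]
  rw [h]
  refine ContDiff.sum fun j _ ↦ ((hT i j).comp contDiff_fst).mul ?_
  exact contDiff_pi.1 (contDiff_fst.comp contDiff_snd) j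

/-- The eigenpair map is `C^∞`. [folklore] -/
theorem contDiff_eigenpairMap {T : ℝ → Matrix (Fin 3) (Fin 3) ℝ}
    (hT : ∀ i j, ContDiff ℝ ∞ fun θ ↦ T θ i j) :
    ContDiff ℝ ∞ fun p : ℝ × ((Fin 3 → ℝ) × ℝ) ↦
      (T p.1 *ᵥ p.2.1 - p.2.2 • p.2.1, p.2.1 ⬝ᵥ p.2.1) := by
  have hv : ContDiff ℝ ∞ fun p : ℝ × ((Fin 3 → ℝ) × ℝ) ↦ p.2.1 := contDiff_fst.comp contDiff_snd
  have hμ : ContDiff ℝ ∞ fun p : ℝ × ((Fin 3 → ℝ) × ℝ) ↦ p.2.2 := contDiff_snd.comp contDiff_snd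
  refine ((contDiff_mulVec_family hT).sub (hμ.smul hv)).prodMk ?_
  have h : (fun p : ℝ × ((Fin 3 → ℝ) × ℝ) ↦ p.2.1 ⬝ᵥ p.2.1) = fun p ↦ ∑ i, p.2.1 i * p.2.1 i := by
    funext p; rfl
  rw [h]
  exact ContDiff.sum fun i _ ↦ (contDiff_pi.1 hv i).mul (contDiff_pi.1 hv i)

/-! ### The partial derivative in `(v, μ)` through directional derivatives -/

/-- **The restriction of the eigenpair map to a line in `(v, μ)`** is the polynomial
`t ↦ (T₀ n - λ n + t ((T₀ - λ) h - η n) - t² η h, ⟨n, n⟩ + 2t⟨n, h⟩ + t²⟨h, h⟩)`; its derivative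
at `t = 0` is `((T₀ - λ) h - η n, 2⟨n, h⟩)`. [folklore] -/
theorem hasDerivAt_eigenpairMap_line (T₀ : Matrix (Fin 3) (Fin 3) ℝ) (n h : Fin 3 → ℝ)
    (lam η : ℝ) :
    HasDerivAt (fun t : ℝ ↦ (T₀ *ᵥ (n + t • h) - (lam + t * η) • (n + t • h),
      (n + t • h) ⬝ᵥ (n + t • h)))
      (T₀ *ᵥ h - lam • h - η • n, 2 * (n ⬝ᵥ h)) 0 := by
  -- first component as a polynomial in `t`
  have e1 : (fun t : ℝ ↦ T₀ *ᵥ (n + t • h) - (lam + t * η) • (n + t • h)) =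
      fun t : ℝ ↦ (T₀ *ᵥ n - lam • n) + t • (T₀ *ᵥ h - lam • h - η • n) + t ^ 2 • (-(η • h)) := by
    funext t
    rw [mulVec_add, mulVec_smul]
    module
  have e2 : (fun t : ℝ ↦ (n + t • h) ⬝ᵥ (n + t • h)) =
      fun t : ℝ ↦ n ⬝ᵥ n + t * (2 * (n ⬝ᵥ h)) + t ^ 2 * (h ⬝ᵥ h) := by
    funext t
    simp only [add_dotProduct, dotProduct_add, smul_dotProduct, dotProduct_smul, smul_eq_mul,
      dotProduct_comm h n]
    ring
  have hA : HasDerivAt (fun t : ℝ ↦ T₀ *ᵥ (n + t • h) - (lam + t * η) • (n + t • h))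
      (T₀ *ᵥ h - lam • h - η • n) 0 := by
    rw [e1]
    have h1 := (((hasDerivAt_id (0 : ℝ)).smul_const (T₀ *ᵥ h - lam • h - η • n)).const_add
      (T₀ *ᵥ n - lam • n)).fun_add ((hasDerivAt_pow 2 (0 : ℝ)).smul_const (-(η • h)))
    simpa using h1
  have hB : HasDerivAt (fun t : ℝ ↦ (n + t • h) ⬝ᵥ (n + t • h)) (2 * (n ⬝ᵥ h)) 0 := by
    rw [e2]
    have h2 := (((hasDerivAt_id (0 : ℝ)).mul_const (2 * (n ⬝ᵥ h))).const_add (n ⬝ᵥ n)).fun_add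
      ((hasDerivAt_pow 2 (0 : ℝ)).mul_const (h ⬝ᵥ h))
    simpa using h2
  exact hA.prodMk hB

/-- **The partial derivative of the eigenpair map in `(v, μ)` at `(θ₀; n, λ)`**:
`(∂f/∂(v, μ)) (h, η) = ((T₀ - λ) h - η n, 2⟨n, h⟩)` (`T₀ = T θ₀`). [folklore] -/
theorem fderiv_inr_apply {T : ℝ → Matrix (Fin 3) (Fin 3) ℝ}
    (hT : ∀ i j, ContDiff ℝ ∞ fun θ ↦ T θ i j) (θ₀ : ℝ) (n : Fin 3 → ℝ) (lam : ℝ)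
    (h : Fin 3 → ℝ) (η : ℝ) :
    (fderiv ℝ (fun p : ℝ × ((Fin 3 → ℝ) × ℝ) ↦
        (T p.1 *ᵥ p.2.1 - p.2.2 • p.2.1, p.2.1 ⬝ᵥ p.2.1)) (θ₀, (n, lam)) ∘L
      ContinuousLinearMap.inr ℝ ℝ ((Fin 3 → ℝ) × ℝ)) (h, η) =
      (T θ₀ *ᵥ h - lam • h - η • n, 2 * (n ⬝ᵥ h)) := by
  set f : ℝ × ((Fin 3 → ℝ) × ℝ) → (Fin 3 → ℝ) × ℝ :=
    fun p ↦ (T p.1 *ᵥ p.2.1 - p.2.2 • p.2.1, p.2.1 ⬝ᵥ p.2.1) with hf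
  have hfd : HasFDerivAt f (fderiv ℝ f (θ₀, (n, lam))) (θ₀, (n, lam)) :=
    (((contDiff_eigenpairMap hT).differentiable (by simp)) _).hasFDerivAt
  -- the partial map and its derivative along the line `t ↦ (n, λ) + t (h, η)`
  have hF₀ : HasFDerivAt (fun p : (Fin 3 → ℝ) × ℝ ↦ f (θ₀, p))
      ((fderiv ℝ f (θ₀, (n, lam))).comp (ContinuousLinearMap.inr ℝ ℝ ((Fin 3 → ℝ) × ℝ)))
      (n, lam) :=
    hfd.comp (n, lam) (hasFDerivAt_prodMk_right θ₀ (n, lam))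
  set ℓ : ℝ → (Fin 3 → ℝ) × ℝ := fun t ↦ (n + t • h, lam + t * η) with hℓ
  have hℓ0 : ℓ 0 = (n, lam) := by simp [hℓ]
  have hℓd : HasDerivAt ℓ (h, η) 0 := by
    refine HasDerivAt.prodMk ?_ ?_
    · simpa using ((hasDerivAt_id (0 : ℝ)).smul_const h).const_add n
    · simpa using ((hasDerivAt_id (0 : ℝ)).mul_const η).const_add lam
  have hF₀' : HasFDerivAt (fun p : (Fin 3 → ℝ) × ℝ ↦ f (θ₀, p))
      ((fderiv ℝ f (θ₀, (n, lam))).comp (ContinuousLinearMap.inr ℝ ℝ ((Fin 3 → ℝ) × ℝ)))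
      (ℓ 0) := by
    rw [hℓ0]; exact hF₀
  have hcomp := HasFDerivAt.comp_hasDerivAt (x := (0 : ℝ)) (f := ℓ) hF₀' hℓd
  -- the same derivative computed explicitly
  have hexp : HasDerivAt ((fun p : (Fin 3 → ℝ) × ℝ ↦ f (θ₀, p)) ∘ ℓ)
      (T θ₀ *ᵥ h - lam • h - η • n, 2 * (n ⬝ᵥ h)) 0 := by
    have e : ((fun p : (Fin 3 → ℝ) × ℝ ↦ f (θ₀, p)) ∘ ℓ) =
        fun t : ℝ ↦ (T θ₀ *ᵥ (n + t • h) - (lam + t * η) • (n + t • h),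
          (n + t • h) ⬝ᵥ (n + t • h)) := by
      funext t; simp [hf, hℓ]
    rw [e]
    exact hasDerivAt_eigenpairMap_line (T θ₀) n h lam η
  exact hcomp.unique hexp

/-- **Invertibility of the partial derivative** at a simple negative eigenpair of a
signature-`(2,1)` matrix (injective by `linearization_injective`, hence bijective).
[cite: Perutz2006, §2.3 (d)] -/
theorem isInvertible_fderiv_inr {T : ℝ → Matrix (Fin 3) (Fin 3) ℝ}
    (hT : ∀ i j, ContDiff ℝ ∞ fun θ ↦ T θ i j) {θ₀ : ℝ} {n : Fin 3 → ℝ} {lam : ℝ}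
    (hsymm : (T θ₀).IsSymm) (hn1 : n ⬝ᵥ n = 1) (hTn : T θ₀ *ᵥ n = lam • n) (hlam : lam < 0)
    (hpos : ∀ v, v ⬝ᵥ n = 0 → v ≠ 0 → 0 < v ⬝ᵥ T θ₀ *ᵥ v) :
    (fderiv ℝ (fun p : ℝ × ((Fin 3 → ℝ) × ℝ) ↦
        (T p.1 *ᵥ p.2.1 - p.2.2 • p.2.1, p.2.1 ⬝ᵥ p.2.1)) (θ₀, (n, lam)) ∘L
      ContinuousLinearMap.inr ℝ ℝ ((Fin 3 → ℝ) × ℝ)).IsInvertible := by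
  set L := fderiv ℝ (fun p : ℝ × ((Fin 3 → ℝ) × ℝ) ↦
      (T p.1 *ᵥ p.2.1 - p.2.2 • p.2.1, p.2.1 ⬝ᵥ p.2.1)) (θ₀, (n, lam)) ∘L
    ContinuousLinearMap.inr ℝ ℝ ((Fin 3 → ℝ) × ℝ) with hL
  have hinj : Injective L := by
    refine (injective_iff_map_eq_zero L).2 fun q hq ↦ ?_
    obtain ⟨h, η⟩ := q
    have hval := fderiv_inr_apply hT θ₀ n lam h η
    rw [← hL] at hval
    rw [hval, Prod.mk_eq_zero] at hq
    obtain ⟨hq1, hq2⟩ := hq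
    have h1 : T θ₀ *ᵥ h - lam • h = η • n := by rw [← sub_eq_zero, ← hq1]
    have h2 : h ⬝ᵥ n = 0 := by
      rw [dotProduct_comm]
      have : (2 : ℝ) ≠ 0 := two_ne_zero
      exact (mul_eq_zero.1 hq2).resolve_left this
    obtain ⟨hh, hη⟩ := linearization_injective hsymm hn1 hTn hlam hpos h1 h2
    rw [hh, hη]; rfl
  have hbij : Bijective L :=
    ⟨hinj, (LinearMap.injective_iff_surjective (f := (L : ((Fin 3 → ℝ) × ℝ) →ₗ[ℝ]
      ((Fin 3 → ℝ) × ℝ)))).1 hinj⟩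
  set e : ((Fin 3 → ℝ) × ℝ) ≃L[ℝ] ((Fin 3 → ℝ) × ℝ) :=
    (LinearEquiv.ofBijective (L : ((Fin 3 → ℝ) × ℝ) →ₗ[ℝ] ((Fin 3 → ℝ) × ℝ))
      hbij).toContinuousLinearEquiv with he
  exact ⟨e, ContinuousLinearMap.ext fun q ↦ rfl⟩

/-! ### The smooth signed negative eigenvector -/

set_option maxHeartbeats 1600000 in
/-- **Smooth (and periodic) dependence of the signed negative eigenvector on parameters.**
Let `T : ℝ → Mat₃(ℝ)` be a `C^∞` family of symmetric matrices, each with a unit eigenvector of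
negative eigenvalue whose orthogonal complement is positive definite (signature `(2, 1)`), and
`w : ℝ → ℝ³` a continuous family with `⟨w θ, T θ w θ⟩ < 0`.  Then there are `C^∞` maps
`N : ℝ → ℝ³`, `Λ : ℝ → ℝ` with `|N θ| = 1`, `T θ N θ = Λ θ N θ`, `Λ θ < 0`, `⟨N θ, w θ⟩ > 0`,
`T θ > 0` on `(N θ)^⊥`, and `N`, `Λ` are `P`-periodic whenever `T` and `w` are.
[cite: Perutz2006, §2.3 (d) and Prop. 2.2] -/
theorem exists_contDiff_signed_negative_eigenvector {T : ℝ → Matrix (Fin 3) (Fin 3) ℝ}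
    (hT : ∀ i j, ContDiff ℝ ∞ fun θ ↦ T θ i j) (hsymm : ∀ θ, (T θ).IsSymm)
    (hsig : ∀ θ, ∃ (n : Fin 3 → ℝ) (lam : ℝ), n ⬝ᵥ n = 1 ∧ T θ *ᵥ n = lam • n ∧ lam < 0 ∧
      ∀ v, v ⬝ᵥ n = 0 → v ≠ 0 → 0 < v ⬝ᵥ T θ *ᵥ v)
    {w : ℝ → Fin 3 → ℝ} (hw : Continuous w) (hwneg : ∀ θ, w θ ⬝ᵥ T θ *ᵥ w θ < 0) :
    ∃ (N : ℝ → Fin 3 → ℝ) (Λ : ℝ → ℝ), ContDiff ℝ ∞ N ∧ ContDiff ℝ ∞ Λ ∧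
      (∀ θ, N θ ⬝ᵥ N θ = 1) ∧ (∀ θ, T θ *ᵥ N θ = Λ θ • N θ) ∧ (∀ θ, Λ θ < 0) ∧
      (∀ θ, 0 < N θ ⬝ᵥ w θ) ∧ (∀ θ v, v ⬝ᵥ N θ = 0 → v ≠ 0 → 0 < v ⬝ᵥ T θ *ᵥ v) ∧
      ∀ P : ℝ, (∀ θ, T (θ + P) = T θ) → (∀ θ, w (θ + P) = w θ) →
        ∀ θ, N (θ + P) = N θ ∧ Λ (θ + P) = Λ θ := by
  -- (1) the signed eigenpair at each `θ`, with its orthogonal positivity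
  have hex : ∀ θ, ∃ p : (Fin 3 → ℝ) × ℝ, p.1 ⬝ᵥ p.1 = 1 ∧ T θ *ᵥ p.1 = p.2 • p.1 ∧ p.2 < 0 ∧
      0 < p.1 ⬝ᵥ w θ ∧ ∀ v, v ⬝ᵥ p.1 = 0 → v ≠ 0 → 0 < v ⬝ᵥ T θ *ᵥ v := by
    intro θ
    obtain ⟨n, lam, hn1, hTn, hlam, hpos⟩ := hsig θ
    obtain ⟨n', hn', hn'1, hTn', hn'w⟩ :=
      exists_signed_negative_eigenvector hn1 hTn hpos (hwneg θ)
    refine ⟨(n', lam), hn'1, hTn', hlam, hn'w, fun v hv hv0 ↦ hpos v ?_ hv0⟩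
    rcases hn' with rfl | rfl
    · exact hv
    · rwa [dotProduct_neg, neg_eq_zero] at hv
  choose p hp1 hp2 hp3 hp4 hp5 using hex
  set N : ℝ → Fin 3 → ℝ := fun θ ↦ (p θ).1 with hN
  set Λ : ℝ → ℝ := fun θ ↦ (p θ).2 with hΛ
  -- (2) uniqueness: any unit eigenvector of negative eigenvalue positively paired with `w θ`
  --     is `N θ`, with eigenvalue `Λ θ`
  have huniq : ∀ θ (m : Fin 3 → ℝ) (μ : ℝ), m ⬝ᵥ m = 1 → T θ *ᵥ m = μ • m → μ < 0 →
      0 < m ⬝ᵥ w θ → m = N θ ∧ μ = Λ θ := by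
    intro θ m μ h1 h2 h3 h4
    obtain ⟨hm, hμ, hΛ'⟩ := signed_negative_eigenvector_unique (hsymm θ) (hp1 θ) (hp2 θ) (hp5 θ)
      h1 h2 h3 h4 (hp1 θ) (hp2 θ) (hp3 θ) (hp4 θ)
    exact ⟨hm, hμ⟩
  -- (3) smoothness of `N` and `Λ` at every `θ₀` by the implicit function theorem
  set f : ℝ × ((Fin 3 → ℝ) × ℝ) → (Fin 3 → ℝ) × ℝ :=
    fun q ↦ (T q.1 *ᵥ q.2.1 - q.2.2 • q.2.1, q.2.1 ⬝ᵥ q.2.1) with hf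
  have hfs : ContDiff ℝ ∞ f := contDiff_eigenpairMap hT
  have hsmooth : ∀ θ₀, ContDiffAt ℝ ∞ (fun θ ↦ (N θ, Λ θ)) θ₀ := by
    intro θ₀
    set u : ℝ × ((Fin 3 → ℝ) × ℝ) := (θ₀, (N θ₀, Λ θ₀)) with hu
    have cdf : ContDiffAt ℝ ∞ f u := hfs.contDiffAt
    have pn : (∞ : WithTop ℕ∞) ≠ 0 := by simp
    have if₂ : (fderiv ℝ f u ∘L ContinuousLinearMap.inr ℝ ℝ ((Fin 3 → ℝ) × ℝ)).IsInvertible :=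
      isInvertible_fderiv_inr hT (hsymm θ₀) (hp1 θ₀) (hp2 θ₀) (hp3 θ₀) (hp5 θ₀)
    set ψ := cdf.implicitFunction pn if₂ with hψ
    have hψs : ContDiffAt ℝ ∞ ψ θ₀ := cdf.contDiffAt_implicitFunction pn if₂
    have hψ0 : ψ θ₀ = (N θ₀, Λ θ₀) := cdf.implicitFunction_apply_self pn if₂
    have hfu : f u = (0, 1) := by
      simp only [hf, hu]
      rw [hp2 θ₀, sub_self, hp1 θ₀]
    have hev : ∀ᶠ θ in 𝓝 θ₀, f (θ, ψ θ) = (0, 1) := by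
      rw [← hfu]; exact cdf.eventually_apply_implicitFunction pn if₂
    -- continuity consequences: negative eigenvalue, positive pairing
    have hψc : ContinuousAt ψ θ₀ := hψs.continuousAt
    have hev2 : ∀ᶠ θ in 𝓝 θ₀, (ψ θ).2 < 0 := by
      have hc : ContinuousAt (fun θ ↦ (ψ θ).2) θ₀ := continuousAt_snd.comp hψc
      have h0 : (ψ θ₀).2 < 0 := by rw [hψ0]; exact hp3 θ₀
      exact hc.eventually (gt_mem_nhds h0)
    have hev3 : ∀ᶠ θ in 𝓝 θ₀, 0 < (ψ θ).1 ⬝ᵥ w θ := by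
      have hc : ContinuousAt (fun θ ↦ (ψ θ).1 ⬝ᵥ w θ) θ₀ := by
        have h1 : ContinuousAt (fun θ ↦ (ψ θ).1) θ₀ := continuousAt_fst.comp hψc
        have h2 : Continuous fun q : (Fin 3 → ℝ) × (Fin 3 → ℝ) ↦ q.1 ⬝ᵥ q.2 :=
          continuous_fst.dotProduct continuous_snd
        exact h2.continuousAt.comp (h1.prodMk hw.continuousAt)
      have h0 : 0 < (ψ θ₀).1 ⬝ᵥ w θ₀ := by rw [hψ0]; exact hp4 θ₀
      exact hc.eventually (lt_mem_nhds h0)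
    -- hence `ψ = (N, Λ)` near `θ₀`
    have heq : (fun θ ↦ (N θ, Λ θ)) =ᶠ[𝓝 θ₀] ψ := by
      filter_upwards [hev, hev2, hev3] with θ h1 h2 h3
      simp only [hf, Prod.mk.injEq] at h1
      obtain ⟨h1a, h1b⟩ := h1
      have heig : T θ *ᵥ (ψ θ).1 = (ψ θ).2 • (ψ θ).1 := sub_eq_zero.1 h1a
      obtain ⟨hm, hμ⟩ := huniq θ (ψ θ).1 (ψ θ).2 h1b heig h2 h3
      exact Prod.ext hm.symm hμ.symm
    exact hψs.congr_of_eventuallyEq heq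
  have hNs : ContDiff ℝ ∞ N := contDiff_iff_contDiffAt.2 fun θ₀ ↦ (hsmooth θ₀).fst
  have hΛs : ContDiff ℝ ∞ Λ := contDiff_iff_contDiffAt.2 fun θ₀ ↦ (hsmooth θ₀).snd
  -- (4) conclusion, with periodicity from uniqueness
  refine ⟨N, Λ, hNs, hΛs, hp1, hp2, hp3, hp4, hp5, fun P hTP hwP θ ↦ ?_⟩
  have h := huniq θ (N (θ + P)) (Λ (θ + P)) (hp1 (θ + P)) (by rw [← hTP θ]; exact hp2 (θ + P))
    (hp3 (θ + P)) (by rw [← hwP θ]; exact hp4 (θ + P))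
  exact h

end Literature.Analysis.Matrix

end
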